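import Mathlib
import Summits.PneNP.PneNP.Theorems.SymmetryBudgetHamCompilesDefs
import Summits.PneNP.PneNP.Theorems.SymmetryBudgetHamCompilesStubCutspanCutParity

/-!
# Slot counts and the odd-pairing criterion for stub `stub_cutspan` of line `kotzig-cutspan`
(crux `SymmetryBudget.HamCompiles`, item stmt-PneNP-10637) — auxiliary file 2

* Path covers (`IsCoverOf`) and slot counts (`fSlots`, `aSlots`), abstractly: end vertices lie in
  the covered set, a cover has at most `|S|` paths, covers transport along an implication of
  adjacencies on `S`; positivity, relabelling and pathwise-equivalent recounting of the slot
  counts; `∑_i #{a ∈ l | f a = i} = |l|`.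
* Instantiation of cut parity (`Cutspan.cutParity`, auxiliary file 1) to the line's cut vectors:
  for an F-family `PF` with end vertices in the free set and rank margins `d`, and a
  rank-labelled A-family `PA` with A-slots `d`,
  `∑_S uF (rk m x) PF S · vA d PA S = 1 ↔ dsupp d ≠ ∅ ∧` the rank-labelled junction graph
  `junctionGraph lab' PF PA` is connected on `dsupp d` (`pairing_eq_one_iff`; `lab'` is any
  `Fin (g m)`-valued labelling agreeing with `rk m x` on the free set).
-/

-- `Summit.PneNP.PneNP.…` duplicates `PneNP` BY DESIGN (single-problem summit, D-0017).
set_option linter.dupNamespace false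

noncomputable section

namespace Summit.PneNP.PneNP.Theorems.HamCompilesKC

open Finset

namespace Cutspan

/-! ### Path covers and slot counts (abstract) -/

section Generic

variable {V : Type*}

/-- The first vertex is listed. -/
theorem first_mem_verts (p : VSeq V) : p.first ∈ p.verts := List.mem_cons_self

/-- The last vertex is listed. -/
theorem last_mem_verts (p : VSeq V) : p.last ∈ p.verts := List.getLast_mem _

/-- A family of (nonempty) vertex sequences has at most as many members as listed vertices. -/
theorem length_le_length_flatten (P : List (VSeq V)) :
    P.length ≤ (P.map VSeq.verts).flatten.length := by
  induction P with
  | nil => simp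
  | cons p P ih =>
    simp only [List.length_cons, List.map_cons, List.flatten_cons, List.length_append,
      VSeq.verts]
    omega

/-- Positivity of F-slots: some path has an end with the given label. -/
theorem fSlots_pos_iff {L : Type*} [DecidableEq L] (lab : V → L) (PF : List (VSeq V)) (i : L) :
    0 < fSlots lab PF i ↔ ∃ p ∈ PF, lab p.first = i ∨ lab p.last = i := by
  unfold fSlots
  rw [Nat.add_pos_iff_pos_or_pos, List.countP_pos_iff, List.countP_pos_iff]
  constructor
  · rintro (⟨p, hp, h⟩ | ⟨p, hp, h⟩)
    · exact ⟨p, hp, Or.inl (by simpa using h)⟩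
    · exact ⟨p, hp, Or.inr (by simpa using h)⟩
  · rintro ⟨p, hp, h | h⟩
    · exact Or.inl ⟨p, hp, by simpa using h⟩
    · exact Or.inr ⟨p, hp, by simpa using h⟩

/-- Positivity of A-slots: some labelled path carries the given label. -/
theorem aSlots_pos_iff {L : Type*} [DecidableEq L] (PA : List (VSeq V × (L × L))) (i : L) :
    0 < aSlots PA i ↔ ∃ q ∈ PA, q.2.1 = i ∨ q.2.2 = i := by
  unfold aSlots
  rw [Nat.add_pos_iff_pos_or_pos, List.countP_pos_iff, List.countP_pos_iff]
  constructor
  · rintro (⟨p, hp, h⟩ | ⟨p, hp, h⟩)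
    · exact ⟨p, hp, Or.inl (by simpa using h)⟩
    · exact ⟨p, hp, Or.inr (by simpa using h)⟩
  · rintro ⟨p, hp, h | h⟩
    · exact Or.inl ⟨p, hp, by simpa using h⟩
    · exact Or.inr ⟨p, hp, by simpa using h⟩

/-- F-slots under a pathwise equivalent change of labelling. -/
theorem fSlots_congr {L L' : Type*} [DecidableEq L] [DecidableEq L'] (lab : V → L) (lab' : V → L')
    (PF : List (VSeq V)) (i : L) (i' : L')
    (h : ∀ p ∈ PF, (lab p.first = i ↔ lab' p.first = i') ∧ (lab p.last = i ↔ lab' p.last = i')) :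
    fSlots lab PF i = fSlots lab' PF i' := by
  unfold fSlots
  congr 1
  · exact List.countP_congr fun p hp => by simp [(h p hp).1]
  · exact List.countP_congr fun p hp => by simp [(h p hp).2]

/-- A-slots of a relabelled family. -/
theorem aSlots_map {L L' : Type*} [DecidableEq L] [DecidableEq L'] (PA : List (VSeq V × (L × L)))
    (φ : L → L') (i : L') :
    aSlots (PA.map fun q => (q.1, (φ q.2.1, φ q.2.2))) i =
      PA.countP (fun q => decide (φ q.2.1 = i)) + PA.countP (fun q => decide (φ q.2.2 = i)) := by
  unfold aSlots
  rw [List.countP_map, List.countP_map]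
  rfl

/-- A-slots against a pathwise equivalent count. -/
theorem aSlots_congr {L : Type*} [DecidableEq L] (PA : List (VSeq V × (L × L))) (i : L)
    (P₁ P₂ : VSeq V × (L × L) → Prop) [DecidablePred P₁] [DecidablePred P₂]
    (h : ∀ q ∈ PA, (q.2.1 = i ↔ P₁ q) ∧ (q.2.2 = i ↔ P₂ q)) :
    aSlots PA i = PA.countP (fun q => decide (P₁ q)) + PA.countP (fun q => decide (P₂ q)) := by
  unfold aSlots
  congr 1
  · exact List.countP_congr fun p hp => by simp [(h p hp).1]
  · exact List.countP_congr fun p hp => by simp [(h p hp).2]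

/-- Summing, over all labels `i < g`, the number of members labelled `i` gives the length, when
every member has a label `< g`. -/
theorem sum_countP_eq_length {α : Type*} {g : ℕ} (f : α → ℕ) (l : List α)
    (hl : ∀ a ∈ l, f a < g) :
    (∑ i : Fin g, l.countP fun a => decide (f a = (i : ℕ))) = l.length := by
  induction l with
  | nil => simp
  | cons a l ih =>
    have ha : f a < g := hl a List.mem_cons_self
    have ih' := ih fun b hb => hl b (List.mem_cons_of_mem a hb)
    simp only [List.countP_cons, Finset.sum_add_distrib, ih', List.length_cons]
    congr 1
    rw [Finset.sum_eq_single (⟨f a, ha⟩ : Fin g)]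
    · simp
    · intro b _ hb
      have : f a ≠ (b : ℕ) := fun h => hb (Fin.ext h.symm)
      simp [this]
    · simp

variable [DecidableEq V]

/-- Listed vertices of a cover of `S` lie in `S`. -/
theorem mem_of_cover {G : SimpleGraph V} {S : Finset V} {P : List (VSeq V)}
    (h : IsCoverOf G S P) {p : VSeq V} (hp : p ∈ P) {u : V} (hu : u ∈ p.verts) : u ∈ S := by
  rw [← h.2.1, List.mem_toFinset, List.mem_flatten]
  exact ⟨p.verts, List.mem_map.2 ⟨p, hp, rfl⟩, hu⟩

/-- The first vertex of a path of a cover of `S` lies in `S`. -/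
theorem first_mem_of_cover {G : SimpleGraph V} {S : Finset V} {P : List (VSeq V)}
    (h : IsCoverOf G S P) {p : VSeq V} (hp : p ∈ P) : p.first ∈ S :=
  mem_of_cover h hp (first_mem_verts p)

/-- The last vertex of a path of a cover of `S` lies in `S`. -/
theorem last_mem_of_cover {G : SimpleGraph V} {S : Finset V} {P : List (VSeq V)}
    (h : IsCoverOf G S P) {p : VSeq V} (hp : p ∈ P) : p.last ∈ S :=
  mem_of_cover h hp (last_mem_verts p)

/-- A cover of `S` has at most `|S|` paths. -/
theorem length_le_card_of_cover {G : SimpleGraph V} {S : Finset V} {P : List (VSeq V)}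
    (h : IsCoverOf G S P) : P.length ≤ S.card := by
  rw [← h.2.1, List.toFinset_card_of_nodup h.1]
  exact length_le_length_flatten P

/-- Covers transport along an implication of adjacencies between vertices of `S`. -/
theorem isCoverOf_of_imp {G G' : SimpleGraph V} {S : Finset V} {P : List (VSeq V)}
    (h : IsCoverOf G S P) (hGG' : ∀ u ∈ S, ∀ v ∈ S, G.Adj u v → G'.Adj u v) :
    IsCoverOf G' S P := by
  refine ⟨h.1, h.2.1, fun p hp => ?_⟩
  exact (h.2.2 p hp).imp_of_mem_imp fun u v hu hv huv =>
    hGG' u (mem_of_cover h hp hu) v (mem_of_cover h hp hv) huv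

end Generic

/-! ### The odd-pairing criterion -/

section Pairing

variable {m : ℕ} (x : Fin m × Fin m → Bool)

open scoped Classical in
/-- Pointwise, the pairing integrand is the indicator of "F-consistent, admissible and
A-consistent". -/
theorem uF_mul_vA {g : ℕ} (lab : Fin m → ℕ) (PF : List (VSeq (Fin m))) (d : Fin g → ℕ)
    (PA : List (VSeq (Fin m) × (Fin g × Fin g))) (S : Fin g → Bool) :
    uF lab PF S * vA d PA S = if consF lab PF S ∧ (Adm d S ∧ consA PA S) then 1 else 0 := by
  unfold uF vA
  by_cases h1 : consF lab PF S <;> by_cases h2 : Adm d S ∧ consA PA S <;> simp [h1, h2]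

/-- Membership in the support of a margin vector. -/
theorem mem_dsupp {g : ℕ} (d : Fin g → ℕ) (i : Fin g) : i ∈ dsupp d ↔ 0 < d i := by
  simp [dsupp]

/-- Admissibility, unfolded at a given nonemptiness witness. -/
theorem adm_iff {g : ℕ} (d : Fin g → ℕ) (hU : (dsupp d).Nonempty) (S : Fin g → Bool) :
    Adm d S ↔ (∀ i, S i = true → i ∈ dsupp d) ∧ S ((dsupp d).min' hU) = true := by
  unfold Adm
  constructor
  · rintro ⟨h1, _, h2⟩
    exact ⟨fun i hi => (mem_dsupp d i).2 (h1 i hi), h2⟩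
  · rintro ⟨h1, h2⟩
    exact ⟨fun i hi => (mem_dsupp d i).1 (h1 i hi), hU, h2⟩

/-- F-consistency through a `Fin (g m)`-valued rank labelling of the free vertices. -/
theorem consF_iff (lab' : Fin m → Fin (gOf m)) (hlab' : ∀ u ∈ freeSet m, (lab' u : ℕ) = rk m x u)
    (PF : List (VSeq (Fin m))) (hends : ∀ p ∈ PF, p.first ∈ freeSet m ∧ p.last ∈ freeSet m)
    (S : Fin (gOf m) → Bool) :
    consF (rk m x) PF S ↔ ∀ p ∈ PF, (S (lab' p.first) = true ↔ S (lab' p.last) = true) := by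
  have h1 : ∀ u ∈ freeSet m,
      (∃ i : Fin (gOf m), S i = true ∧ (i : ℕ) = rk m x u) ↔ S (lab' u) = true := by
    intro u hu
    constructor
    · rintro ⟨i, hi, hiu⟩
      have : i = lab' u := Fin.ext (by rw [hiu, hlab' u hu])
      rw [← this]
      exact hi
    · intro h
      exact ⟨lab' u, h, hlab' u hu⟩
  unfold consF
  refine forall₂_congr fun p hp => ?_
  rw [h1 _ (hends p hp).1, h1 _ (hends p hp).2]

end Pairing

/-- **The odd-pairing criterion** (cut parity instantiated). For an F-family `PF` with ends in the
free set and rank margins `d`, and a rank-labelled A-family `PA` with A-slots `d`: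
`∑_S uF S · vA S = 1` iff the support of `d` is nonempty and the rank-labelled junction graph is
connected on it. -/
theorem pairing_eq_one_iff {m : ℕ} (x : Fin m × Fin m → Bool) (lab' : Fin m → Fin (gOf m))
    (hlab' : ∀ u ∈ freeSet m, (lab' u : ℕ) = rk m x u)
    (PF : List (VSeq (Fin m))) (hends : ∀ p ∈ PF, p.first ∈ freeSet m ∧ p.last ∈ freeSet m)
    (d : Fin (gOf m) → ℕ) (hdF : ∀ i : Fin (gOf m), fSlots (rk m x) PF (i : ℕ) = d i)
    (PA : List (VSeq (Fin m) × (Fin (gOf m) × Fin (gOf m)))) (hdA : ∀ i, aSlots PA i = d i) :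
    (∑ S, uF (rk m x) PF S * vA d PA S = 1) ↔
      (dsupp d).Nonempty ∧
        ∀ i ∈ dsupp d, ∀ j ∈ dsupp d, (junctionGraph lab' PF PA).Reachable i j := by
  classical
  simp_rw [uF_mul_vA]
  by_cases hU : (dsupp d).Nonempty
  · rw [iff_true_intro hU, true_and]
    -- the edge relation of the rank-labelled junction graph
    let E : Fin (gOf m) → Fin (gOf m) → Prop := fun i j =>
      (∃ p ∈ PF, lab' p.first = i ∧ lab' p.last = j) ∨ (∃ q ∈ PA, q.2.1 = i ∧ q.2.2 = j)
    have hE : ∀ i j, E i j → i ∈ dsupp d ∧ j ∈ dsupp d := by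
      rintro i j (⟨p, hp, rfl, rfl⟩ | ⟨q, hq, rfl, rfl⟩)
      · constructor
        · rw [mem_dsupp, ← hdF, fSlots_pos_iff]
          exact ⟨p, hp, Or.inl (hlab' _ (hends p hp).1).symm⟩
        · rw [mem_dsupp, ← hdF, fSlots_pos_iff]
          exact ⟨p, hp, Or.inr (hlab' _ (hends p hp).2).symm⟩
      · constructor
        · rw [mem_dsupp, ← hdA, aSlots_pos_iff]
          exact ⟨q, hq, Or.inl rfl⟩
        · rw [mem_dsupp, ← hdA, aSlots_pos_iff]
          exact ⟨q, hq, Or.inr rfl⟩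
    have hP : ∀ S, (consF (rk m x) PF S ∧ (Adm d S ∧ consA PA S)) ↔
        (∀ i, S i = true → i ∈ dsupp d) ∧ S ((dsupp d).min' hU) = true ∧
          ∀ i j, E i j → (S i = true ↔ S j = true) := by
      intro S
      rw [consF_iff x lab' hlab' PF hends, adm_iff d hU]
      constructor
      · rintro ⟨hF, ⟨h1, h2⟩, hA⟩
        refine ⟨h1, h2, ?_⟩
        rintro i j (⟨p, hp, rfl, rfl⟩ | ⟨q, hq, rfl, rfl⟩)
        · exact hF p hp
        · exact hA q hq
      · rintro ⟨h1, h2, h3⟩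
        exact ⟨fun p hp => h3 _ _ (Or.inl ⟨p, hp, rfl, rfl⟩), ⟨h1, h2⟩,
          fun q hq => h3 _ _ (Or.inr ⟨q, hq, rfl, rfl⟩)⟩
    have hJ : junctionGraph lab' PF PA = SimpleGraph.fromRel E := rfl
    rw [hJ]
    exact cutParity (dsupp d) hU E hE _ hP
  · rw [iff_false_intro hU, false_and, iff_false]
    have hAdm : ∀ S, ¬ Adm d S := fun S h => hU h.2.1
    simp [hAdm]


end Cutspan

end Summit.PneNP.PneNP.Theorems.HamCompilesKC
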